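import Literature.Computability.Complexity.Tensor
import Mathlib.Algebra.QuadraticDiscriminant
import HarnessLib

/-!
# The zig-zag product and its basic spectral bound (Reingold–Vadhan–Wigderson, Thm. 3.2)

"Let `G₁` be a `D₁`-regular graph on `[N₁]` with rotation map `Rot_{G₁}` and `G₂` a `D₂`-regular graph on
`[D₁]`.  Their zig-zag product `G₁ ⓩ G₂` is the `D₂²`-regular graph on `[N₁] × [D₁]` whose rotation map
is: `Rot((v,k),(i,j))`: let `(k',i') = Rot_{G₂}(k,i)`, `(w,l') = Rot_{G₁}(v,k')`, `(l,j') = Rot_{G₂}(l',j)`,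
output `((w,l),(j',i'))`" (Reingold–Vadhan–Wigderson 2002, Def. 3.1), and **Theorem 3.2**:
`λ(G₁ ⓩ G₂) ≤ λ₁ + λ₂ + λ₂²`, with "the basic analysis" of §3.4: the walk matrix is `M = B̃ Â B̃`
(`B̃ = I ⊗ B` the cloud-wise step, `Â` the permutation matrix of `Rot_{G₁}`); for `v ⊥ 1` write
`v = v_∥ + v_⊥` (constant on clouds / summing to zero on each cloud); then
`⟨M v, v⟩ = ⟨Â B̃ v, B̃ v⟩`, `B̃ v_∥ = v_∥`, `‖B̃ v_⊥‖ ≤ λ₂ ‖v_⊥‖`, `|⟨Â v_∥, v_∥⟩| ≤ λ₁ ‖v_∥‖²`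
(it is `D₁ ⟨A r, r⟩` for the cloud means `r`), so `|⟨M v, v⟩| ≤ λ₁‖v_∥‖² + 2λ₂‖v_∥‖‖v_⊥‖ + λ₂²‖v_⊥‖²
≤ (λ₁ + λ₂ + λ₂²) ‖v‖²`.  Since `M` is symmetric this Rayleigh bound is a bound on `‖M v‖`
(`spectralBound_of_rayleigh`, by polarization and a discriminant).  Used with the algebraic base
graphs of `AffinePlane.lean` to build the explicit expander family replacing the brute-force base of
Arora–Barak 2009, Thm. 21.19.

* `RotGraph.zigzag G H : RotGraph (N * D) (d * d)`, `zigzag_nbr`;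
* `spectralBound_of_rayleigh` — for a walk matrix, `|⟨v, A v⟩| ≤ ρ ‖v‖²` on `v ⊥ 1` gives `SpectralBound A ρ`;
* `rayleigh_zigzag_le` — the array inequality; **`spectralBound_zigzag`** — `λ(G ⓩ H) ≤ λ_G + λ_H + λ_H²`.

## References

* O. Reingold, S. Vadhan, A. Wigderson, *Entropy waves, the zig-zag graph product, and new
  constant-degree expanders*, Ann. of Math. 155 (2002), Def. 3.1, Thm. 3.2, §3.4 (basic analysis).
* S. Arora, B. Barak, *Computational Complexity: A Modern Approach*, CUP 2009, §21.3.4–21.3.5.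
-/

noncomputable section

namespace Literature.Computability.Complexity

open Finset Matrix

namespace Expander

/-! ### Rayleigh bounds give spectral bounds for walk matrices -/

/-- **A Rayleigh-quotient bound is a spectral bound** for a symmetric doubly stochastic matrix: if
`|⟨v, A v⟩| ≤ ρ ‖v‖²` for all `v ⊥ 1` (`ρ ≥ 0`) then `‖A v‖² ≤ ρ² ‖v‖²` for all `v ⊥ 1` (polarization
`4⟨A v, w⟩ = ⟨A(v+w), v+w⟩ - ⟨A(v-w), v-w⟩` with `w = t · A v`, then the discriminant in `t`).
[cite: ReingoldVadhanWigderson2002, §3.4 (λ as the maximum of |⟨α, Mα⟩|/⟨α,α⟩ for symmetric M)] -/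
theorem spectralBound_of_rayleigh {n : ℕ} {A : Matrix (Fin n) (Fin n) ℝ} (hA : IsWalkMatrix A) {ρ : ℝ} (hρ : 0 ≤ ρ)
    (h : ∀ v : Fin n → ℝ, ∑ i, v i = 0 → |v ⬝ᵥ (A *ᵥ v)| ≤ ρ * (v ⬝ᵥ v)) : SpectralBound A ρ := by
  refine ⟨hρ, fun v hv => ?_⟩
  -- the symmetric bilinear form `β x y = x ⬝ (A y)`
  have hsymm : ∀ x y : Fin n → ℝ, x ⬝ᵥ (A *ᵥ y) = y ⬝ᵥ (A *ᵥ x) := fun x y => by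
    rw [dotProduct_mulVec, ← mulVec_transpose, hA.1.eq, dotProduct_comm]
  have hwsum : ∑ i, (A *ᵥ v) i = 0 := by rw [hA.sum_mulVec, hv]
  have hW0 : 0 ≤ (A *ᵥ v) ⬝ᵥ (A *ᵥ v) := by simp only [dotProduct]; exact sum_nonneg fun i _ => mul_self_nonneg _
  have hV0 : 0 ≤ v ⬝ᵥ v := by simp only [dotProduct]; exact sum_nonneg fun i _ => mul_self_nonneg _
  -- expansions of `β (v ± t w) (v ± t w)` and `‖v ± t w‖²` for `w = A v`
  have hexp : ∀ t : ℝ, (v + t • (A *ᵥ v)) ⬝ᵥ (A *ᵥ (v + t • (A *ᵥ v))) - (v - t • (A *ᵥ v)) ⬝ᵥ (A *ᵥ (v - t • (A *ᵥ v))) =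
      4 * t * ((A *ᵥ v) ⬝ᵥ (A *ᵥ v)) := by
    intro t
    have hvAw : v ⬝ᵥ (A *ᵥ (A *ᵥ v)) = (A *ᵥ v) ⬝ᵥ (A *ᵥ v) := hsymm v (A *ᵥ v)
    simp only [mulVec_add, mulVec_sub, mulVec_smul, add_dotProduct, sub_dotProduct, dotProduct_add, dotProduct_sub,
      dotProduct_smul, smul_dotProduct, smul_eq_mul, hvAw]
    ring
  have hnorm : ∀ t : ℝ, (v + t • (A *ᵥ v)) ⬝ᵥ (v + t • (A *ᵥ v)) + (v - t • (A *ᵥ v)) ⬝ᵥ (v - t • (A *ᵥ v)) =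
      2 * (v ⬝ᵥ v) + 2 * (t * t) * ((A *ᵥ v) ⬝ᵥ (A *ᵥ v)) := by
    intro t
    simp only [add_dotProduct, sub_dotProduct, dotProduct_add, dotProduct_sub, dotProduct_smul, smul_dotProduct, smul_eq_mul,
      dotProduct_comm (A *ᵥ v) v]
    ring
  -- the quadratic `2ρ W t² - 4 W t + 2ρ V ≥ 0` for all real `t`
  have hquad : ∀ t : ℝ, 0 ≤ 2 * ρ * ((A *ᵥ v) ⬝ᵥ (A *ᵥ v)) * (t * t) + -(4 * ((A *ᵥ v) ⬝ᵥ (A *ᵥ v))) * t + 2 * ρ * (v ⬝ᵥ v) := by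
    intro t
    rcases le_or_gt t 0 with ht | ht
    · have h1 : 0 ≤ 2 * ρ * ((A *ᵥ v) ⬝ᵥ (A *ᵥ v)) * (t * t) := by have := mul_self_nonneg t; positivity
      nlinarith
    · have hp := h (v + t • (A *ᵥ v)) (by simp [sum_add_distrib, ← mul_sum, hv, hwsum])
      have hm := h (v - t • (A *ᵥ v)) (by simp [sum_sub_distrib, ← mul_sum, hv, hwsum])
      have hsub : 4 * t * ((A *ᵥ v) ⬝ᵥ (A *ᵥ v)) ≤ ρ * ((v + t • (A *ᵥ v)) ⬝ᵥ (v + t • (A *ᵥ v))) +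
          ρ * ((v - t • (A *ᵥ v)) ⬝ᵥ (v - t • (A *ᵥ v))) := by
        rw [← hexp t]
        have h1 := le_abs_self ((v + t • (A *ᵥ v)) ⬝ᵥ (A *ᵥ (v + t • (A *ᵥ v))))
        have h2 := neg_abs_le ((v - t • (A *ᵥ v)) ⬝ᵥ (A *ᵥ (v - t • (A *ᵥ v))))
        linarith
      have := hnorm t
      nlinarith
  -- discriminant
  have hdisc := discrim_le_zero hquad
  rw [discrim] at hdisc
  by_cases hW : (A *ᵥ v) ⬝ᵥ (A *ᵥ v) = 0
  · rw [hW]; positivity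
  have hWpos : 0 < (A *ᵥ v) ⬝ᵥ (A *ᵥ v) := lt_of_le_of_ne hW0 (Ne.symm hW)
  -- `16 W² - 16 ρ² W V ≤ 0`
  have h1 : (A *ᵥ v) ⬝ᵥ (A *ᵥ v) * ((A *ᵥ v) ⬝ᵥ (A *ᵥ v) - ρ ^ 2 * (v ⬝ᵥ v)) ≤ 0 := by nlinarith
  have h2 : (A *ᵥ v) ⬝ᵥ (A *ᵥ v) - ρ ^ 2 * (v ⬝ᵥ v) ≤ 0 := by
    by_contra hcon
    push Not at hcon
    nlinarith
  linarith

namespace RotGraph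

variable {N D d : ℕ}

/-! ### The zig-zag product -/

/-- The rotation map of the zig-zag product: zig in the cloud, step along the big edge, zag in the new cloud.
[cite: ReingoldVadhanWigderson2002, Def. 3.1] -/
def zigzagRot (G : RotGraph N D) (H : RotGraph D d) (x : Fin (N * D) × Fin (d * d)) : Fin (N * D) × Fin (d * d) :=
  let v := (finProdFinEquiv.symm x.1).1
  let k := (finProdFinEquiv.symm x.1).2
  let i := (finProdFinEquiv.symm x.2).1
  let j := (finProdFinEquiv.symm x.2).2
  let zig := H.rot (k, i)
  let big := G.rot (v, zig.1)
  let zag := H.rot (big.2, j)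
  (finProdFinEquiv (big.1, zag.1), finProdFinEquiv (zag.2, zig.2))

/-- **The zig-zag product `G ⓩ H`** of a `D`-regular `G` on `N` vertices with a `d`-regular `H` on `D`
vertices: `N D` vertices, degree `d²`. [cite: ReingoldVadhanWigderson2002, Def. 3.1] -/
def zigzag (G : RotGraph N D) (H : RotGraph D d) : RotGraph (N * D) (d * d) where
  rot := zigzagRot G H
  rot_rot x := by
    unfold zigzagRot
    simp only [Equiv.symm_apply_apply, Prod.mk.eta, H.rot_rot, G.rot_rot, Equiv.apply_symm_apply]

variable (G : RotGraph N D) (H : RotGraph D d)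

/-- The neighbours in the zig-zag product. [cite: ReingoldVadhanWigderson2002, Def. 3.1] -/
theorem zigzag_nbr (v : Fin N) (k : Fin D) (i j : Fin d) :
    (G.zigzag H).nbr (finProdFinEquiv (v, k)) (finProdFinEquiv (i, j)) =
      finProdFinEquiv (G.nbr v (H.nbr k i), H.nbr (G.rlab v (H.nbr k i)) j) := by
  show (zigzagRot G H (finProdFinEquiv (v, k), finProdFinEquiv (i, j))).1 = _
  unfold zigzagRot
  simp only [Equiv.symm_apply_apply]
  rfl

/-! ### The operators on arrays -/

section

variable {G H}

/-- The cloud-wise step `B̃ = I ⊗ B`: `(B̃ V)(v,k) = (1/d) ∑ⱼ V v (nbr_H k j)`. [cite: ReingoldVadhanWigderson2002, §3.2 (B̃)] -/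
def cloudOp (H : RotGraph D d) (V : Fin N → Fin D → ℝ) (v : Fin N) (k : Fin D) : ℝ := (∑ j, V v (H.nbr k j)) / d

/-- The big step `Â` (the permutation of the rotation map of `G`): `(Â V)(v,k) = V (Rot_G(v,k))`. [cite: ReingoldVadhanWigderson2002, §3.2 (Â)] -/
def bigOp (G : RotGraph N D) (V : Fin N → Fin D → ℝ) (v : Fin N) (k : Fin D) : ℝ := V (G.nbr v k) (G.rlab v k)

/-- The Frobenius inner product of arrays. [folklore] -/
def inner2 (X Y : Fin N → Fin D → ℝ) : ℝ := ∑ v, ∑ k, X v k * Y v k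

/-- `Â` is symmetric (the rotation map is an involution). [cite: ReingoldVadhanWigderson2002, §3.2] -/
theorem inner2_bigOp_comm (X Y : Fin N → Fin D → ℝ) : inner2 (bigOp G X) Y = inner2 X (bigOp G Y) := by
  unfold inner2 bigOp
  conv_rhs => rw [← G.sum_sum_nbr_rlab fun v k => X v k * Y (G.nbr v k) (G.rlab v k)]
  refine sum_congr rfl fun v _ => sum_congr rfl fun k _ => ?_
  rw [nbr_rlab, rlab_rlab]

/-- `Â` preserves the norm. [cite: ReingoldVadhanWigderson2002, §3.2] -/
theorem inner2_bigOp_self (X : Fin N → Fin D → ℝ) : inner2 (bigOp G X) (bigOp G X) = inner2 X X := by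
  unfold inner2 bigOp
  exact G.sum_sum_nbr_rlab fun v k => X v k * X v k

/-- Cauchy–Schwarz for the Frobenius inner product. [folklore] -/
theorem inner2_le (X Y : Fin N → Fin D → ℝ) : inner2 X Y ^ 2 ≤ inner2 X X * inner2 Y Y := by
  unfold inner2
  simp only [← Fintype.sum_prod_type']
  have h := sum_mul_sq_le_sq_mul_sq (univ : Finset (Fin N × Fin D)) (fun p => X p.1 p.2) fun p => Y p.1 p.2
  simpa [sq] using h

/-- `B̃` is symmetric (the walk matrix of `H` is). [cite: ReingoldVadhanWigderson2002, §3.2] -/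
theorem inner2_cloudOp_comm (hd : 0 < d) (X Y : Fin N → Fin D → ℝ) : inner2 (cloudOp H X) Y = inner2 X (cloudOp H Y) := by
  unfold inner2
  refine sum_congr rfl fun v _ => ?_
  have hX : ∀ k, cloudOp H X v k = (H.walkMatrix *ᵥ X v) k := fun k => by rw [cloudOp, walkMatrix_mulVec]
  have hY : ∀ k, cloudOp H Y v k = (H.walkMatrix *ᵥ Y v) k := fun k => by rw [cloudOp, walkMatrix_mulVec]
  simp only [hX, hY]
  have h1 : ∑ k, (H.walkMatrix *ᵥ X v) k * Y v k = (H.walkMatrix *ᵥ X v) ⬝ᵥ Y v := rfl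
  have h2 : ∑ k, X v k * (H.walkMatrix *ᵥ Y v) k = X v ⬝ᵥ (H.walkMatrix *ᵥ Y v) := rfl
  rw [h1, h2, dotProduct_mulVec, ← mulVec_transpose, (H.isWalkMatrix_walkMatrix hd).1.eq]

/-- The zig-zag walk operator on arrays is `B̃ Â B̃`. [cite: ReingoldVadhanWigderson2002, §3.2 (M = B̃ Â B̃)] -/
theorem zigzag_avg_eq (V : Fin N → Fin D → ℝ) (v : Fin N) (k : Fin D) :
    (∑ x : Fin (d * d), V (finProdFinEquiv.symm ((G.zigzag H).nbr (finProdFinEquiv (v, k)) x)).1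
        (finProdFinEquiv.symm ((G.zigzag H).nbr (finProdFinEquiv (v, k)) x)).2) / (d * d : ℝ) =
      cloudOp H (bigOp G (cloudOp H V)) v k := by
  unfold cloudOp bigOp
  simp only [← sum_div]
  rw [div_div, mul_comm (d : ℝ) d]
  congr 1
  rw [← Fintype.sum_prod_type']
  refine Fintype.sum_equiv finProdFinEquiv.symm _ _ fun x => ?_
  conv_lhs => rw [← finProdFinEquiv.apply_symm_apply x,
    show finProdFinEquiv.symm x = ((finProdFinEquiv.symm x).1, (finProdFinEquiv.symm x).2) from rfl, zigzag_nbr]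
  simp only [Equiv.symm_apply_apply]

/-- Cloud means. [folklore] -/
def cloudMean (V : Fin N → Fin D → ℝ) (v : Fin N) : ℝ := (∑ k, V v k) / D

/-- **The Rayleigh bound of the basic zig-zag theorem** on arrays with total sum zero:
`|⟨B̃ Â B̃ V, V⟩| ≤ (λ_G + λ_H + λ_H²) ‖V‖²`. [cite: ReingoldVadhanWigderson2002, Thm. 3.2 and §3.4] -/
theorem rayleigh_zigzag_le (hD : 0 < D) (hd : 0 < d) {lam mu : ℝ} (hG : SpectralBound G.walkMatrix lam)
    (hH : SpectralBound H.walkMatrix mu) (V : Fin N → Fin D → ℝ) (hV : ∑ v, ∑ k, V v k = 0) :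
    |inner2 (cloudOp H (bigOp G (cloudOp H V))) V| ≤ (lam + mu + mu ^ 2) * inner2 V V := by
  have hDR : (0 : ℝ) < D := by exact_mod_cast hD
  have hl0 := hG.1
  have hm0 := hH.1
  -- decomposition
  set r := cloudMean V with hr
  set P : Fin N → Fin D → ℝ := fun v _ => r v with hP
  set W : Fin N → Fin D → ℝ := fun v k => V v k - r v with hW
  have hWrow : ∀ v, ∑ k, W v k = 0 := fun v => by
    simp only [hW, sum_sub_distrib, sum_const, card_univ, Fintype.card_fin, nsmul_eq_mul, hr, cloudMean]
    field_simp; ring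
  have hrsum : ∑ v, r v = 0 := by simp only [hr, cloudMean, ← sum_div, hV, zero_div]
  have hVPW : ∀ v k, V v k = P v k + W v k := fun v k => by simp [hP, hW]
  -- `B̃ P = P`, `Y := B̃ W` with `‖Y‖ ≤ μ ‖W‖`
  have hBP : cloudOp H P = P := by
    funext v k
    simp only [cloudOp, hP, sum_const, card_univ, Fintype.card_fin, nsmul_eq_mul]
    have hdR : (d : ℝ) ≠ 0 := by exact_mod_cast hd.ne'
    field_simp
  set Y := cloudOp H W with hY
  have hdne : (d : ℝ) ≠ 0 := by exact_mod_cast hd.ne'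
  have hBV : cloudOp H V = fun v k => P v k + Y v k := by
    funext v k
    rw [hY]
    simp only [cloudOp]
    rw [show (∑ j, V v (H.nbr k j)) = ∑ j, (r v + W v (H.nbr k j)) from sum_congr rfl fun j _ => by rw [hVPW, hP],
      sum_add_distrib, sum_const, card_univ, Fintype.card_fin, nsmul_eq_mul, add_div, mul_div_cancel_left₀ _ hdne, hP]
  have hYY : inner2 Y Y ≤ mu ^ 2 * inner2 W W := by
    unfold inner2
    rw [mul_sum]
    refine sum_le_sum fun v _ => ?_
    have h := hH.2 (W v) (hWrow v)
    have hYv : ∀ k, Y v k = (H.walkMatrix *ᵥ W v) k := fun k => by rw [hY, cloudOp, walkMatrix_mulVec]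
    simp only [hYv]
    exact h
  -- norms
  have hPP : inner2 P P = D * ∑ v, r v ^ 2 := by
    simp only [inner2, hP, sum_const, card_univ, Fintype.card_fin, nsmul_eq_mul, ← sq, mul_sum]
  have hVV : inner2 V V = inner2 P P + inner2 W W := by
    have hcross : ∀ v, ∑ k, P v k * W v k = 0 := fun v => by simp only [hP, ← mul_sum, hWrow, mul_zero]
    unfold inner2
    rw [← sum_add_distrib]
    refine sum_congr rfl fun v _ => ?_
    rw [← sum_add_distrib]
    calc ∑ k, V v k * V v k = ∑ k, (P v k * P v k + W v k * W v k + 2 * (P v k * W v k)) :=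
          sum_congr rfl fun k _ => by rw [hVPW]; ring
      _ = ∑ k, (P v k * P v k + W v k * W v k) + 2 * ∑ k, P v k * W v k := by rw [sum_add_distrib, mul_sum]
      _ = ∑ k, (P v k * P v k + W v k * W v k) := by rw [hcross, mul_zero, add_zero]
  have hPP0 : 0 ≤ inner2 P P := by unfold inner2; exact sum_nonneg fun v _ => sum_nonneg fun k _ => mul_self_nonneg _
  have hWW0 : 0 ≤ inner2 W W := by unfold inner2; exact sum_nonneg fun v _ => sum_nonneg fun k _ => mul_self_nonneg _
  have hYY0 : 0 ≤ inner2 Y Y := by unfold inner2; exact sum_nonneg fun v _ => sum_nonneg fun k _ => mul_self_nonneg _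
  -- `⟨M V, V⟩ = ⟨Â B̃ V, B̃ V⟩ = ⟨Â P, P⟩ + 2 ⟨Â P, Y⟩ + ⟨Â Y, Y⟩`
  have hMVV : inner2 (cloudOp H (bigOp G (cloudOp H V))) V = inner2 (bigOp G P) P + 2 * inner2 (bigOp G P) Y + inner2 (bigOp G Y) Y := by
    rw [inner2_cloudOp_comm hd, hBV]
    have hlinB : bigOp G (fun v k => P v k + Y v k) = fun v k => bigOp G P v k + bigOp G Y v k := by funext v k; rfl
    rw [hlinB]
    have : inner2 (fun v k => bigOp G P v k + bigOp G Y v k) (fun v k => P v k + Y v k) =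
        inner2 (bigOp G P) P + inner2 (bigOp G P) Y + inner2 (bigOp G Y) P + inner2 (bigOp G Y) Y := by
      unfold inner2; simp only [← sum_add_distrib]; exact sum_congr rfl fun v _ => sum_congr rfl fun k _ => by ring
    rw [this, inner2_bigOp_comm (G := G) Y P]
    unfold inner2 at *
    have : ∑ v, ∑ k, Y v k * bigOp G P v k = ∑ v, ∑ k, bigOp G P v k * Y v k := sum_congr rfl fun v _ => sum_congr rfl fun k _ => mul_comm _ _
    rw [this]; ring
  -- `|a| ≤ b` from `a² ≤ b²`, `b ≥ 0`
  have habs : ∀ {a b : ℝ}, a ^ 2 ≤ b ^ 2 → 0 ≤ b → |a| ≤ b := fun h hb => abs_le.2 (abs_le_of_sq_le_sq' h hb)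
  -- the three bounds
  have h1 : |inner2 (bigOp G P) P| ≤ lam * inner2 P P := by
    -- `⟨Â P, P⟩ = D ⟨r, A r⟩`, `|⟨r, A r⟩| ≤ ‖r‖ ‖A r‖ ≤ λ ‖r‖²`
    have hAP : inner2 (bigOp G P) P = D * (r ⬝ᵥ (G.walkMatrix *ᵥ r)) := by
      simp only [inner2, bigOp, hP, dotProduct, walkMatrix_mulVec, mul_sum]
      refine sum_congr rfl fun v _ => ?_
      have hDne : (D : ℝ) ≠ 0 := hDR.ne'
      have hcalc : (D : ℝ) * (r v * ((∑ i, r (G.nbr v i)) / D)) = r v * ∑ i, r (G.nbr v i) := by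
        field_simp
      rw [hcalc, mul_sum]
      exact sum_congr rfl fun k _ => mul_comm _ _
    have hsp := hG.2 r hrsum
    have hrr0 : 0 ≤ r ⬝ᵥ r := by simp only [dotProduct]; exact sum_nonneg fun i _ => mul_self_nonneg _
    have hrr : r ⬝ᵥ r = ∑ v, r v ^ 2 := by simp [dotProduct, sq]
    have hcs : (r ⬝ᵥ (G.walkMatrix *ᵥ r)) ^ 2 ≤ (r ⬝ᵥ r) * ((G.walkMatrix *ᵥ r) ⬝ᵥ (G.walkMatrix *ᵥ r)) := by
      have h := sum_mul_sq_le_sq_mul_sq (univ : Finset (Fin N)) r (G.walkMatrix *ᵥ r)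
      simpa [dotProduct, sq] using h
    have hb : (r ⬝ᵥ (G.walkMatrix *ᵥ r)) ^ 2 ≤ (lam * (r ⬝ᵥ r)) ^ 2 :=
      calc _ ≤ (r ⬝ᵥ r) * ((G.walkMatrix *ᵥ r) ⬝ᵥ (G.walkMatrix *ᵥ r)) := hcs
        _ ≤ (r ⬝ᵥ r) * (lam ^ 2 * (r ⬝ᵥ r)) := mul_le_mul_of_nonneg_left hsp hrr0
        _ = (lam * (r ⬝ᵥ r)) ^ 2 := by ring
    have hrAr : |r ⬝ᵥ (G.walkMatrix *ᵥ r)| ≤ lam * (r ⬝ᵥ r) := habs hb (mul_nonneg hl0 hrr0)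
    rw [hAP, hPP, abs_mul, abs_of_pos hDR, ← hrr]
    calc (D : ℝ) * |r ⬝ᵥ (G.walkMatrix *ᵥ r)| ≤ D * (lam * (r ⬝ᵥ r)) := mul_le_mul_of_nonneg_left hrAr hDR.le
      _ = lam * (D * (r ⬝ᵥ r)) := by ring
  have h2 : |inner2 (bigOp G P) Y| ≤ mu * (Real.sqrt (inner2 P P) * Real.sqrt (inner2 W W)) := by
    have hcs := inner2_le (bigOp G P) Y
    rw [inner2_bigOp_self] at hcs
    refine habs ?_ (by positivity)
    rw [mul_pow, mul_pow, Real.sq_sqrt hPP0, Real.sq_sqrt hWW0]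
    calc inner2 (bigOp G P) Y ^ 2 ≤ inner2 P P * inner2 Y Y := hcs
      _ ≤ inner2 P P * (mu ^ 2 * inner2 W W) := mul_le_mul_of_nonneg_left hYY hPP0
      _ = mu ^ 2 * (inner2 P P * inner2 W W) := by ring
  have h3 : |inner2 (bigOp G Y) Y| ≤ inner2 Y Y := by
    have hcs := inner2_le (bigOp G Y) Y
    rw [inner2_bigOp_self] at hcs
    exact habs (by rw [sq (inner2 Y Y)]; exact hcs) hYY0
  -- assemble: `λ‖P‖² + 2μ‖P‖‖W‖ + μ²‖W‖² ≤ (λ + μ + μ²)(‖P‖² + ‖W‖²)`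
  rw [hMVV, hVV]
  have hsP := Real.sq_sqrt hPP0
  have hsW := Real.sq_sqrt hWW0
  have h2ab : 2 * (Real.sqrt (inner2 P P) * Real.sqrt (inner2 W W)) ≤ inner2 P P + inner2 W W := by
    nlinarith [sq_nonneg (Real.sqrt (inner2 P P) - Real.sqrt (inner2 W W))]
  calc |inner2 (bigOp G P) P + 2 * inner2 (bigOp G P) Y + inner2 (bigOp G Y) Y|
      ≤ |inner2 (bigOp G P) P| + 2 * |inner2 (bigOp G P) Y| + |inner2 (bigOp G Y) Y| := by
        refine (abs_add_le _ _).trans (add_le_add ((abs_add_le _ _).trans (add_le_add le_rfl ?_)) le_rfl)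
        rw [abs_mul, abs_two]
    _ ≤ lam * inner2 P P + 2 * (mu * (Real.sqrt (inner2 P P) * Real.sqrt (inner2 W W))) + inner2 Y Y := by
        linarith [h1, h2, h3]
    _ ≤ lam * inner2 P P + mu * (inner2 P P + inner2 W W) + mu ^ 2 * inner2 W W := by
        nlinarith [mul_le_mul_of_nonneg_left h2ab hm0, hYY]
    _ ≤ (lam + mu + mu ^ 2) * (inner2 P P + inner2 W W) := by
        nlinarith [mul_nonneg hl0 hWW0, mul_nonneg (sq_nonneg mu) hPP0, mul_nonneg hm0 hPP0, mul_nonneg hm0 hWW0]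

end

/-- **Reingold–Vadhan–Wigderson, Theorem 3.2 (basic zig-zag bound)**, for the tree's spectral bounds:
`λ(G ⓩ H) ≤ λ_G + λ_H + λ_H²`. [cite: ReingoldVadhanWigderson2002, Thm. 3.2] -/
theorem spectralBound_zigzag (hD : 0 < D) (hd : 0 < d) {lam mu : ℝ} (hG : SpectralBound G.walkMatrix lam)
    (hH : SpectralBound H.walkMatrix mu) : SpectralBound (G.zigzag H).walkMatrix (lam + mu + mu ^ 2) := by
  have hdd : 0 < d * d := Nat.mul_pos hd hd
  refine spectralBound_of_rayleigh ((G.zigzag H).isWalkMatrix_walkMatrix hdd) (by have := hG.1; have := hH.1; positivity)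
    fun v hv => ?_
  set V : Fin N → Fin D → ℝ := fun a b => v (finProdFinEquiv (a, b)) with hVdef
  have hV : ∑ a, ∑ b, V a b = 0 := by
    rw [← Fintype.sum_prod_type', ← hv]
    exact Fintype.sum_equiv finProdFinEquiv _ _ fun p => rfl
  have hMv : ∀ a b, ((G.zigzag H).walkMatrix *ᵥ v) (finProdFinEquiv (a, b)) = cloudOp H (bigOp G (cloudOp H V)) a b := by
    intro a b
    rw [walkMatrix_mulVec, ← zigzag_avg_eq, Nat.cast_mul]
    congr 1
    refine sum_congr rfl fun x _ => ?_
    simp only [hVdef]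
    rw [show ((finProdFinEquiv.symm ((G.zigzag H).nbr (finProdFinEquiv (a, b)) x)).1,
        (finProdFinEquiv.symm ((G.zigzag H).nbr (finProdFinEquiv (a, b)) x)).2) =
        finProdFinEquiv.symm ((G.zigzag H).nbr (finProdFinEquiv (a, b)) x) from rfl, Equiv.apply_symm_apply]
  have hinner : v ⬝ᵥ ((G.zigzag H).walkMatrix *ᵥ v) = inner2 (cloudOp H (bigOp G (cloudOp H V))) V := by
    unfold inner2
    simp only [dotProduct]
    rw [← Fintype.sum_prod_type']
    refine Fintype.sum_equiv finProdFinEquiv.symm _ _ fun x => ?_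
    conv_lhs => rw [← finProdFinEquiv.apply_symm_apply x]
    rw [show finProdFinEquiv.symm x = ((finProdFinEquiv.symm x).1, (finProdFinEquiv.symm x).2) from rfl, hMv, mul_comm]
  have hvv : v ⬝ᵥ v = inner2 V V := by
    unfold inner2
    simp only [dotProduct]
    rw [← Fintype.sum_prod_type']
    refine Fintype.sum_equiv finProdFinEquiv.symm _ _ fun x => ?_
    simp only [hVdef]
    rw [show ((finProdFinEquiv.symm x).1, (finProdFinEquiv.symm x).2) = finProdFinEquiv.symm x from rfl, Equiv.apply_symm_apply]
  rw [hinner, hvv]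
  exact rayleigh_zigzag_le hD hd hG hH V hV

end RotGraph

end Expander

end Literature.Computability.Complexity

end
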